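import Summits.MatrixMultiplication.MatrixMultiplication.Theses.HiddenToeplitzCorners
import Summits.MatrixMultiplication.MatrixMultiplication.Theorems.HiddenToeplitzCornersCostGlue
import Summits.MatrixMultiplication.MatrixMultiplication.Theorems.HiddenToeplitzCornersLiftGlue

/-!
# `HiddenToeplitzCorners.Assembly` (stmt-MatrixMultiplication-7500) — proved

The assembly item of route `MatrixMultiplication/HiddenToeplitzCorners`:
`Assembly : AndrewsLifting → ToeplitzLikeDetCost → HiddenCorners → MatrixMultiplication`.

Pure logic over the two glue supports already proved in the tree:
`costGlue_proof : ToeplitzLikeDetCost → HiddenCorners → CheapIdealMembers`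
(HiddenToeplitzCornersCostGlue.lean, stmt-7498) and
`liftGlue_proof : AndrewsLifting → CheapIdealMembers → MatrixMultiplication`
(HiddenToeplitzCornersLiftGlue.lean, stmt-7499).  Given the three hypotheses, `CostGlue` produces
cheap nonzero members of the determinantal ideal `(det X_r)` for infinitely many `r`, and
`LiftGlue` (Andrews lifting + Bini + the flattening bound) turns them into `ω(ℂ) = 2`.
No statement is restated; the theorem's type is literally the route decl.
-/

namespace Summit.MatrixMultiplication.MatrixMultiplication.Theorems

/-- **Item `stmt-MatrixMultiplication-7500` (`Assembly`), exact signature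
`AndrewsLifting → ToeplitzLikeDetCost → HiddenCorners → MatrixMultiplication`.**
Composition of the proved glue supports: `costGlue_proof hT hH : CheapIdealMembers` and
`liftGlue_proof hA _ : MatrixMultiplication`. [folklore] -/
theorem hiddenToeplitzCorners_assembly_proof :
    Summit.MatrixMultiplication.MatrixMultiplication.Theses.HiddenToeplitzCorners.Assembly := by
  unfold Summit.MatrixMultiplication.MatrixMultiplication.Theses.HiddenToeplitzCorners.Assembly
  intro hA hT hH
  exact liftGlue_proof hA (costGlue_proof hT hH)

end Summit.MatrixMultiplication.MatrixMultiplication.Theorems
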